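import Literature.NumberTheory.EllipticCurves.StabilisedLevelLoweringCongruence
import Literature.NumberTheory.EllipticCurves.ModularCurve
import Literature.NumberTheory.EllipticCurves.GaloisAction
import Literature.NumberTheory.EllipticCurves.PAdicHeights
import Mathlib.NumberTheory.Padics.Complex
import HarnessLib

/-!
# Level lowering at one multiplicative prime, in `Γ₀(N/q)`-newform currency, at `p = 3`
# (Ribet 1990 / Diamond 1995 Thm. 6.4 + Carayol, semistable case)

Topic `NumberTheory/EllipticCurves`; namespace `Literature.NumberTheory.EllipticCurves`. ONE named fact
(`def … : Prop`, nothing asserted, nothing admitted) + its `Iff.rfl` unfolding lemma, typed for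
the `bsd-addord` cell (work item `wi-76329`, consumers `stmt-BirchSwinnertonDyer-19679` / `…-19562`, residual
(R1) of `Summit.…KimAtThreeDeepLowerOffStratumLevelLoweringVatsalStabRows`): the conclusion is, symbol for
symbol, the input block `(g, IsNewform0 g, ¬ q ∣ M, hcℓ, haq)` of
`isStabilisedLevelLoweringCongruenceIn_three_of_levelLoweredNewform` and of
`stub_nonAdditive_semistable_of_vatsal_of_levelLoweredNewform` there (congruences read in `ℚ̄₃ = PadicAlgCl 3`
through a field isomorphism `ι : ℚ̄₃ ≃+* ℂ`, i.e. modulo the prime of `ℚ̄ ⊂ ℂ` over `3` that `ι` singles out).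
The tree's `Literature.NumberTheory.Automorphic.diamond1995_refinedSerre` is Diamond's Thm. 1.1 in
`Γ₁(N(ρ̄))` / Serre-weight currency with congruences off `3N(ρ̄)` only; this file packages the weight-two
`Γ₀`-form of the same circle of results (Diamond's Thm. 6.4 / Cor. 6.5) together with the local bookkeeping an
elliptic-curve consumer needs, in elliptic-curve currency.

## What is packaged, and why the hypotheses are what they are

For a SEMISTABLE elliptic curve `E/ℚ` (globally minimal model `W₀`, square-free conductor `N = Mq`, `q ∤ M`
prime, `q ≠ 3`) with `ρ̄ = ρ̄_{E,3} : G_ℚ → GL₂(𝔽₃)` SURJECTIVE, split multiplicative reduction at `q` and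
`3 ∣ ord_q(Δ_E)`:

1. (Tate curve) for `ℓ ≠ 3`, `ρ̄` is unramified at `ℓ` iff `3 ∣ ord_ℓ(Δ_E)`; `ρ̄` is finite (flat) at `3` iff
   `3 ∣ ord_3(Δ_E)` [cite: Stevens1997OverviewFLT, §2.10]. Hence `ρ̄` is unramified at `q`, and under the
   displayed hypotheses it is ramified at every prime `ℓ ∣ M`, `ℓ ≠ 3`, so that Serre's prime-to-`3` conductor
   is `N(ρ̄) = ∏_{ℓ ∣ M, ℓ ≠ 3} ℓ` [cite: Edixhoven1997, §1, (1.6.1)]; and `ρ̄` is NOT finite at `3` when `3 ∣ M`.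
2. `ρ̄` is irreducible, modular (from the newform `f_E ∈ S₂(Γ₀(N))`), and — its image being all of `GL₂(𝔽₃)` —
   not induced from a character of `G_{ℚ(√−3)}`. DIAMOND'S THEOREM 6.4 (the case `ℓ = 3` is explicitly
   included) [cite: Diamond1995RefinedSerre, Thm. 6.4 and Cor. 6.5], which packages RIBET'S level-lowering
   theorem [cite: Ribet1990, Thm. 1.1] with Carayol's lemma [cite: Carayol1989] and Mazur's principle, gives a
   weight-two NEWFORM `g` of conductor `N_g ∣ 9·N(ρ̄)` with `ρ̄ ≅ ρ̄_g` and `det ρ_g = χ·χ₃`, `χ` of order prime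
   to `3` — hence `χ = 1` (its reduction is `det ρ̄ · χ̄₃⁻¹ = 1` and prime-to-`3` roots of unity inject mod `3`),
   i.e. `g` has trivial character, `g ∈ S₂(Γ₀(N_g))`; moreover `3 ∤ N_g` if `ρ̄|_{D_3}` is finite, and, if
   `ρ̄|_{D_3}` is `ψ₀`-Selmer (the multiplicative and the good ordinary cases, `ψ₀(Frob₃) = a_3(E) mod 3`),
   `9 ∤ N_g` and `a_3(g) ≡ ψ₀(Frob_3)`. The same lowering for square-free level and every `p ≥ 3` is
   [cite: Edixhoven1997, Thm. 3.1].
3. The level is exactly `M`: `N(ρ̄) ∣ N_g` (conductor = level, [cite: Carayol1986, Thm. (A)]), so every `ℓ ∣ M`,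
   `ℓ ≠ 3` divides `N_g ∣ 9·N(ρ̄)`; if `3 ∤ N` then `ρ̄` is finite at `3` (good reduction) and `3 ∤ N_g`, so
   `N_g = N(ρ̄) = M`; if `3 ∣ M` then `ρ̄` is Selmer and not finite, so `3 ∥ N_g` (a level prime to `3` would make
   `ρ̄` finite) and `N_g = 3·N(ρ̄) = M`.
4. The congruences `a_ℓ(g) ≡ a_ℓ(E)` modulo the chosen prime over `3`: at `ℓ ∤ 3N` both sides are
   `tr ρ̄(Frob_ℓ)`; at `ℓ = q`, `a_q(g) = tr ρ̄_g(Frob_q) ≡ tr ρ̄_E(Frob_q) = q + 1` (`ρ̄_E|_{G_q}` is unramified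
   with semisimplification `χ̄₃ ⊕ 1` in the split case); at `ℓ ∣ M`, `ℓ ≠ 3`, both `a_ℓ = ±1` are the value at
   `Frob_ℓ` of the unramified character through which `G_{ℚ_ℓ}` acts on the UNIQUE unramified quotient line
   of `ρ̄|_{G_{ℚ_ℓ}}` (unique because `ρ̄` is ramified at `ℓ`) — local–global compatibility for `g` at `ℓ ∥ N_g`
   [cite: Carayol1986, Thm. (A)] and the Tate curve for `E` (equivalently: Diamond's Cor. 6.5, type A is
   preserved); at `ℓ = 3 ∣ M` this is Thm. 6.4's `a_3(g) ≡ ψ₀(Frob_3)`; at `ℓ = 3 ∤ N` both are read off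
   `ρ̄|_{G_{ℚ_3}}` (ordinary: the unramified quotient character, Thm. 6.4 again; supersingular: `a_3 ≡ 0` on both
   sides by Fontaine's theorem) [cite: Edixhoven1997, §2, Thms. 2.5–2.6]. Replacing `g` by a
   `Gal(ℚ̄/ℚ)`-conjugate realises the congruences at the prime over `3` singled out by any given `ι`.

NOT VENDORED (work-item text vs. print): the requested hypothesis-free form «for every `E` of conductor `N`,
`q ∥ N`, `ρ̄_{E,3}` irreducible and unramified at `q`, there is a NEWFORM of level exactly `N/q` congruent to
`f_E` at EVERY prime `ℓ ≠ q`» is not a printed theorem at `p = 3` and can fail: (a) if `ρ̄` is also unramified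
at another `ℓ' ∥ N`, Ribet's theorem lowers `ℓ'` as well, and a newform of the then NON-OPTIMAL level `N/q`
(Diamond–Taylor's theorem on non-optimal levels is for `p ≥ 5`) need not have the sign `a_{ℓ'} = a_{ℓ'}(E)`:
for `ℓ' ≡ 2 (mod 3)` the local representation `ρ̄|_{G_{ℓ'}} ≅ χ̄ ⊕ χ̄·χ̄₃` has Frobenius eigenvalues `{1, −1}`
whatever the sign, so it does not determine it; (b) if `3 ∥ N` and `ρ̄` is finite at `3`, the optimal level
drops the prime `3`. Both degenerate cases are excluded by the displayed `ord_ℓ(Δ_E)` hypotheses, which are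
decidable row by row (they hold whenever every multiplicative prime `ℓ ≠ q` of `E`, split or non-split, has
`3 ∤ ord_ℓ(Δ_E)`; NB at a non-split prime the Tamagawa number does not detect this). The additive
(non-semistable) case needs the Carayol–Livné conductor-drop analysis at the additive primes and is not
packaged here.
-- TODO(general form): every `p ≥ 5` (Diamond–Taylor non-optimal levels then removes hypothesis (a)), and
-- the additive primes.

## References

* F. Diamond, *The refined conjecture of Serre*, in: Elliptic Curves, Modular Forms & Fermat's Last Theorem
  (Hong Kong 1993), International Press (1995) 22–37, Thm. 1.1, Cor. 1.2, §2 (Carayol's lemma), Thm. 6.4,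
  Cor. 6.5. [Diamond1995RefinedSerre]
* K. A. Ribet, *On modular representations of Gal(ℚ̄/ℚ) arising from modular forms*, Invent. Math. 100
  (1990) 431–476, Thm. 1.1. [Ribet1990]
* B. Edixhoven, *Serre's conjecture*, in: Cornell–Silverman–Stevens (eds.), Modular Forms and Fermat's Last
  Theorem (Springer 1997), §1 ((1.6.1), Prop. 1.10, Thm. 1.12), Prop. 2.1, Thms. 2.5–2.6, Thm. 3.1. [Edixhoven1997]
* G. Stevens, *An overview of the proof of Fermat's Last Theorem*, ibid., §2.10. [Stevens1997OverviewFLT]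
* H. Carayol, Ann. Sci. ÉNS 19 (1986) 409–468, Thm. (A) [Carayol1986]; Duke Math. J. 59 (1989) 785–801
  [Carayol1989].
-/

noncomputable section

open scoped MatrixGroups ModularForm

open CongruenceSubgroup WeierstrassCurve Literature.NumberTheory.EllipticCurves.ModularForms

namespace Literature.NumberTheory.EllipticCurves

/-- **Level lowering at one multiplicative prime in `Γ₀(N/q)`-newform currency, `p = 3`, semistable case**
(Ribet 1990, Thm. 1.1, in the weight-two packaging of Diamond 1995, Thm. 6.4 / Cor. 6.5 — the case `ℓ = 3`
included under «not induced from `ℚ(√−3)`», automatic for surjective `ρ̄` — with Carayol's conductor = level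
and local–global compatibility; see the module docstring for the clause-by-clause derivation and for why the
two `ord_ℓ(Δ)` hypotheses cannot be dropped). For a globally minimal `W₀/ℚ`, elliptic, with `ρ̄_{E,3}`
SURJECTIVE, square-free conductor `N = M·q`, `q` a prime `≠ 3` not dividing `M`, of SPLIT multiplicative
reduction, with `3 ∣ ord_q(Δ)` (`ρ̄` unramified at `q`), such that `3 ∤ ord_ℓ(Δ)` for every prime `ℓ ∣ M`, `ℓ ≠ 3`
(`ρ̄` ramified at the other bad primes) and `3 ∤ ord_3(Δ)` if `3 ∣ M` (`ρ̄` not finite at `3`): for the newform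
`f = D₀.f ∈ S₂(Γ₀(Mq))` of `W₀` and every field isomorphism `ι : ℚ̄₃ ≃+* ℂ` there is a NEWFORM
`g ∈ S₂(Γ₀(M))` with `a_ℓ(g) ≡ a_ℓ(f)` for every prime `ℓ ≠ q` and `a_q(g) ≡ q + 1`, the congruences being
modulo the maximal ideal of `𝒪_{ℚ̄₃}` after transport by `ι⁻¹`.
[cite: Diamond1995RefinedSerre, Thm. 6.4 and Cor. 6.5] [cite: Ribet1990, Thm. 1.1]
[cite: Edixhoven1997, Thm. 3.1 and Prop. 2.1] [cite: Stevens1997OverviewFLT, §2.10] [cite: Carayol1986, Thm. (A)] -/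
def ribet1990_levelLowering_gamma0_newform_at_three : Prop :=
  ∀ (W₀ : WeierstrassCurve ℚ) [W₀.IsElliptic] [W₀.IsGloballyMinimal],
    W₀.HasSurjectiveModNGaloisRep 3 →
    ∀ {M q : ℕ} [NeZero M] [Fact q.Prime], q ≠ 3 → ¬ q ∣ M → Squarefree M →
      M * q = W₀.conductorNorm ℤ →
      W₀.HasSplitMultiplicativeReductionAtPrime q →
      (3 : ℤ) ∣ padicValRat q W₀.Δ →
      (∀ ℓ : ℕ, ℓ.Prime → ℓ ∣ M → ℓ ≠ 3 → ¬ (3 : ℤ) ∣ padicValRat ℓ W₀.Δ) →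
      (3 ∣ M → ¬ (3 : ℤ) ∣ padicValRat 3 W₀.Δ) →
      ∀ (D₀ : ModularParametrizationData W₀ (M * q)) (ι : PadicAlgCl 3 ≃+* ℂ),
        ∃ g : CuspForm (Gamma0 M) 2, IsNewform0 g ∧
          (∀ ℓ : ℕ, ℓ.Prime → ℓ ≠ q → Valued.v (ι.symm (cuspCoeff D₀.f ℓ - cuspCoeff g ℓ)) < 1) ∧
          Valued.v (ι.symm (cuspCoeff g q - (q + 1))) < 1

/-- Unfolding lemma (the fact is a `Prop`-valued definition; this is its statement).
[cite: Diamond1995RefinedSerre, Thm. 6.4 and Cor. 6.5] [cite: Ribet1990, Thm. 1.1] -/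
theorem ribet1990_levelLowering_gamma0_newform_at_three_iff :
    ribet1990_levelLowering_gamma0_newform_at_three ↔
      ∀ (W₀ : WeierstrassCurve ℚ) [W₀.IsElliptic] [W₀.IsGloballyMinimal],
        W₀.HasSurjectiveModNGaloisRep 3 →
        ∀ {M q : ℕ} [NeZero M] [Fact q.Prime], q ≠ 3 → ¬ q ∣ M → Squarefree M →
          M * q = W₀.conductorNorm ℤ →
          W₀.HasSplitMultiplicativeReductionAtPrime q →
          (3 : ℤ) ∣ padicValRat q W₀.Δ →
          (∀ ℓ : ℕ, ℓ.Prime → ℓ ∣ M → ℓ ≠ 3 → ¬ (3 : ℤ) ∣ padicValRat ℓ W₀.Δ) →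
          (3 ∣ M → ¬ (3 : ℤ) ∣ padicValRat 3 W₀.Δ) →
          ∀ (D₀ : ModularParametrizationData W₀ (M * q)) (ι : PadicAlgCl 3 ≃+* ℂ),
            ∃ g : CuspForm (Gamma0 M) 2, IsNewform0 g ∧
              (∀ ℓ : ℕ, ℓ.Prime → ℓ ≠ q → Valued.v (ι.symm (cuspCoeff D₀.f ℓ - cuspCoeff g ℓ)) < 1) ∧
              Valued.v (ι.symm (cuspCoeff g q - (q + 1))) < 1 :=
  Iff.rfl

end Literature.NumberTheory.EllipticCurves

end
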